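import Summits.QuantumFields.BalabanUV.T4Continuum.Support.NE7StrippedConstraintLinearisation
import Literature.MathematicalPhysics.QuantumFieldTheory.Balaban1983to89.B7Prop6GeneralAnalytic
import HarnessLib

/-!
# NE7StrippedConstraintC2 — THE STRIPPED CONSTRAINT MAP IS `C²` (indeed real-analytic) AT `0`: [Balaban1985Averaging] Prop. 7 ANALYTICITY OF THE DOUBLE-BAR TOWER IN THE FIELD, READ IN THE CHARTS
# (lineage `b2b-balaban-t4-ne7-p1`, gen 119, file H8 = ROAD-G119 §5 S2)

Cell `pub-balaban`, rung (B)+1 sub-cell t4, CRUX PROVER NE7 #1 (OWNER of row NE7), generation 119.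
Over ✓ `B7Prop6GeneralAnalytic.prop4_general_analyticAt` (the level fields `logCovIter L U₀ (B t) j` of the double-bar tower are analytic in any analytic family `t ↦ B t` of inserted fields, in
the regime of [Balaban1985Averaging] Prop. 4 at the background `U₀`; lit-balaban r04), H7 ✓ `NE7StrippedConstraintLinearisation` (the chart coordinate of the stripped configuration is the level
field `Ad_{V₀}⁻¹ logCovIter_{j+1}` bondwise, in the regime) and H6 ✓ `NE7StrippedConstraintMap` (`Ψ = strippedConstraint`).
WHAT ([folklore]; 0 def, 0 sorry; general `d`, `L ≥ 2`): `analyticAt_logCovIter_chartDir` (each top-torus component of `X ↦ logCovIter L U♯ (adField U♯ X̃) (j+1)` is `ℂ`-analytic at `0` on the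
complex parameter space `TDir`); `contDiffAt_levelField` (the `TDir N`-valued level field is `C^∞` over `ℝ` at `0`); `strippedConstraint_eq_skewPR_levelField` (in the regime with `b ≥ ‖X‖`:
`Ψ(X) = skewPR(res(Ad_{V₀}⁻¹ logCovIter_{j+1}))`); **`contDiffAt_strippedConstraint`**: `ContDiffAt ℝ 2 (strippedConstraint L N j U♯) 0` under the background letters of H7 (`0 < α₀`, `C0·α₀ ≤ 1∕3`,
`4α₀ ≤ c2′`, `pdev U♯ < α₀L^{-2(j+1)}`, room `exp(3200(d+1)²(d+4)α₀) ≤ 3∕2`) — the hypothesis `ContDiffAt ℝ 2 Ψ 0` of H3 ✓ `NE7StrippedConstraintSocket`, DISCHARGED for the stripped tower.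
HONEST FRAMING (page 1): composition of landed kernel theorems; background letters are HYPOTHESES (for the minimiser they follow from the class radius, successor); nothing of Bałaban's asserted (Prop. 4,
Prop. 7 context only — the tree's `prop4_general_analyticAt` is a proved theorem about OUR objects); NOT (G′), NOT NE7 as a spine node; spine 0∕9; finite T⁴ rung (B)+1 — NOT infinite volume, NOT mass gap,
NOT BetaPertH, NOT Clay.
-/

set_option autoImplicit false

open scoped BigOperators Matrix Matrix.Norms.L2Operator Topology
open Filter

namespace Summit.QuantumFields.BalabanUV.T4Continuum.NE7StrippedConstraintC2

open Literature.MathematicalPhysics.QuantumFieldTheory.Balaban1983to89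
open B7Prop1Explicit B7Prop2Explicit B7Prop3Flat MatrixLog
open B7Eq92Concrete (dbavgCovIter)
open B7Prop4GeneralLevels (logCovIter)
open B7Prop6GeneralAnalytic (prop4_general_analyticAt)
open B7BlockAvgLog (mlog_exp)
open T4AveragingDeficitWall (Ad IsUnitaryCfg SmallField)
open AveragingDeficitTorusChart (TDir chartDir redN)
open AveragingDeficitChartCalculus (relLog)
open AveragingDeficitTwoLevelPrep (skewSub skewPR)
open AveragingDeficitMultiLevelPrep (tower cavgIter LevelSmall tower_ne_zero)
open AveragingDeficitMultiLevelBridge (cavgIter_eq_avgIter)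
open NE3TangentCovariantTower (QbarIter)
open NE3.QbarDictionary (adField)
open NE3.PairLandauB8Avg (relPert)
open NE7AccumulatedFrameDictionary (level_dictionary)
open NE7StrippedConstraintMap (strippedCfg strippedConstraint)
open NE7StrippedConstraintLinearisation (norm_chartDir_le expUnit_Ad_mul)

noncomputable section

variable {d : ℕ} {n : Type} [Fintype n] [DecidableEq n]

/-- **EACH COMPONENT OF THE LEVEL FIELD IS `ℂ`-ANALYTIC IN THE TORUS DIRECTION AT `0`**: under the background letters (with the empty-field smallness `exp(3200(d+1)²(d+4)α₀) ≤ 2`),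
`X ↦ logCovIter L U♯ (adField U♯ X̃) (j+1) z μ` is analytic at `0` on the complex space `TDir d n M`. [cite: Balaban1985Averaging, Prop. 4 p.38, Prop. 7 p.44] -/
theorem analyticAt_logCovIter_chartDir [Nonempty n] {L M : ℕ} [NeZero M] (hL : 2 ≤ L) (j : ℕ)
    {Us : Site d → Fin d → (Matrix n n ℂ)ˣ} (hUu : IsUnitaryCfg Us) {α₀ : ℝ} (hα : 0 < α₀) (hα3 : B7Prop2Explicit.C0 d * α₀ ≤ 1 / 3)
    (hα4 : 4 * α₀ ≤ B7Prop2Explicit.c2' d L) (h52 : B7Prop2Explicit.pdev Us < α₀ * (((L : ℝ) ^ (j + 1))⁻¹) ^ 2)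
    (hroom : Real.exp (4 * (800 * ((d : ℝ) + 1) ^ 2 * ((d : ℝ) + 4)) * α₀) ≤ 2) (z : Site d) (μ : Fin d) :
    AnalyticAt ℂ (fun X : TDir d n M => logCovIter L Us (adField Us (chartDir (ContinuousLinearMap.id ℝ (Matrix n n ℂ)) M X)) (j + 1) z μ) 0 := by
  letI : CStarAlgebra (Matrix n n ℂ) := {}
  have hG := avgClosed_unitaryUnits d (𝔸 := Matrix n n ℂ) L
  have hU₀ : ∀ (y : Site d) (κ : Fin d), Us y κ ∈ unitaryUnits (Matrix n n ℂ) := hUu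
  -- the inserted family `B X = adField U♯ X̃` is bondwise a continuous `ℂ`-linear function of `X`, hence analytic
  have hBa : ∀ (x : Site d) (κ : Fin d), AnalyticAt ℂ
      (fun X : TDir d n M => adField Us (chartDir (ContinuousLinearMap.id ℝ (Matrix n n ℂ)) M X) x κ) 0 := by
    intro x κ
    have hev : AnalyticAt ℂ (fun X : TDir d n M => X (redN M x) κ) 0 :=
      ((ContinuousLinearMap.proj (R := ℂ) κ).comp (ContinuousLinearMap.proj (R := ℂ) (φ := fun _ : Fin d → Fin M => Fin d → Matrix n n ℂ) (redN M x))).analyticAt 0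
    show AnalyticAt ℂ (fun X : TDir d n M => Ad (Us x κ) (X (redN M x) κ)) 0
    unfold Ad
    exact (analyticAt_const.mul hev).mul analyticAt_const
  have hB0 : ∀ (x : Site d) (κ : Fin d), ‖adField Us (chartDir (ContinuousLinearMap.id ℝ (Matrix n n ℂ)) M (0 : TDir d n M)) x κ‖ ≤ 0 := by
    intro x κ
    simp [adField, chartDir, T4AveragingDeficitWall.Ad]
  have hsmall : Real.exp (4 * (800 * ((d : ℝ) + 1) ^ 2 * ((d : ℝ) + 4)) * α₀) * (1 + 8 * (131072 * ((d : ℝ) + 1) ^ 2) * ((L : ℝ) ^ (j + 1) * 0)) ≤ 2 := by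
    rw [mul_zero, mul_zero, add_zero, mul_one]; exact hroom
  have hc₃ : 2 * ((L : ℝ) ^ (j + 1) * 0) ≤ B7Prop3Flat.c3 d L := by
    rw [mul_zero, mul_zero]; unfold B7Prop3Flat.c3; positivity
  exact prop4_general_analyticAt L hL hG (j + 1) Us hU₀ hα hα3 hα4 h52 _ hBa le_rfl hB0 hsmall hc₃ (j + 1) le_rfl z μ

/-- **THE LEVEL FIELD, READ ON THE TOP TORUS, IS SMOOTH OVER `ℝ` AT `0`**: `X ↦ (r, κ) ↦ Ad_{V₀(b)}⁻¹ logCovIter L U♯ (adField U♯ X̃) (j+1) (boxVec N r) κ` is `ContDiffAt ℝ 2` at `0`. [folklore] -/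
theorem contDiffAt_levelField [Nonempty n] {L M N : ℕ} [NeZero M] (hL : 2 ≤ L) (j : ℕ)
    {Us : Site d → Fin d → (Matrix n n ℂ)ˣ} (hUu : IsUnitaryCfg Us) {α₀ : ℝ} (hα : 0 < α₀) (hα3 : B7Prop2Explicit.C0 d * α₀ ≤ 1 / 3)
    (hα4 : 4 * α₀ ≤ B7Prop2Explicit.c2' d L) (h52 : B7Prop2Explicit.pdev Us < α₀ * (((L : ℝ) ^ (j + 1))⁻¹) ^ 2)
    (hroom : Real.exp (4 * (800 * ((d : ℝ) + 1) ^ 2 * ((d : ℝ) + 4)) * α₀) ≤ 2) :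
    ContDiffAt ℝ 2 (fun X : TDir d n M => fun (r : Fin d → Fin N) (κ : Fin d) =>
      Ad (avgIter L Us (j + 1) (boxVec N r) κ)⁻¹
        (logCovIter L Us (adField Us (chartDir (ContinuousLinearMap.id ℝ (Matrix n n ℂ)) M X)) (j + 1) (boxVec N r) κ)) 0 := by
  refine contDiffAt_pi.mpr fun r => contDiffAt_pi.mpr fun κ => ?_
  have han := analyticAt_logCovIter_chartDir (M := M) hL j hUu hα hα3 hα4 h52 hroom (boxVec N r) κ
  have hC : ContDiffAt ℝ 2 (fun X : TDir d n M =>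
      logCovIter L Us (adField Us (chartDir (ContinuousLinearMap.id ℝ (Matrix n n ℂ)) M X)) (j + 1) (boxVec N r) κ) 0 :=
    (han.contDiffAt (n := 2)).restrict_scalars ℝ
  show ContDiffAt ℝ 2 (fun X : TDir d n M => Ad (avgIter L Us (j + 1) (boxVec N r) κ)⁻¹
      (logCovIter L Us (adField Us (chartDir (ContinuousLinearMap.id ℝ (Matrix n n ℂ)) M X)) (j + 1) (boxVec N r) κ)) 0
  unfold Ad
  exact (contDiffAt_const.mul hC).mul contDiffAt_const

/-- **IN THE REGIME, THE STRIPPED CONSTRAINT IS THE SKEW PROJECTION OF THE LEVEL FIELD READ ON THE TORUS**: for `X` with `‖X‖ ≤ b` and the Prop-4 smallness at radius `b` (and `2L^{j+1}b < log 2`),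
`strippedConstraint L N j U♯ X = skewPR N ((r,κ) ↦ Ad_{V₀(b)}⁻¹ logCovIter L U♯ (adField U♯ X̃) (j+1) (boxVec N r) κ)`. [folklore] -/
theorem strippedConstraint_eq_skewPR_levelField [Nonempty n] {L N : ℕ} [NeZero L] [NeZero N] (hL : 2 ≤ L) (j : ℕ)
    {Us : Site d → Fin d → (Matrix n n ℂ)ˣ} (hUu : IsUnitaryCfg Us) {α₀ b : ℝ} (hα : 0 < α₀) (hα3 : B7Prop2Explicit.C0 d * α₀ ≤ 1 / 3)
    (hα4 : 4 * α₀ ≤ B7Prop2Explicit.c2' d L) (h52 : B7Prop2Explicit.pdev Us < α₀ * (((L : ℝ) ^ (j + 1))⁻¹) ^ 2)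
    (X : ↥(skewSub d n (L * tower L N j))) (hXb : ‖X‖ ≤ b)
    (hsmall : Real.exp (4 * (800 * ((d : ℝ) + 1) ^ 2 * ((d : ℝ) + 4)) * α₀) * (1 + 8 * (131072 * ((d : ℝ) + 1) ^ 2) * ((L : ℝ) ^ (j + 1) * b)) ≤ 2)
    (hc₃ : 2 * ((L : ℝ) ^ (j + 1) * b) ≤ B7Prop3Flat.c3 d L) (hlog : 2 * ((L : ℝ) ^ (j + 1) * b) < Real.log 2) :
    strippedConstraint L N j Us X
      = skewPR N (fun (r : Fin d → Fin N) (κ : Fin d) =>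
          Ad (avgIter L Us (j + 1) (boxVec N r) κ)⁻¹
            (logCovIter L Us (adField Us (chartDir (ContinuousLinearMap.id ℝ (Matrix n n ℂ)) (L * tower L N j) (X : TDir d n (L * tower L N j)))) (j + 1) (boxVec N r) κ)) := by
  have hb : 0 ≤ b := (norm_nonneg _).trans hXb
  have hXb' : ∀ (y : Site d) (κ : Fin d), ‖chartDir (ContinuousLinearMap.id ℝ (Matrix n n ℂ)) (L * tower L N j) (X : TDir d n (L * tower L N j)) y κ‖ ≤ b :=
    fun y κ => (norm_chartDir_le (X : TDir d n (L * tower L N j)) y κ).trans hXb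
  obtain ⟨-, hii, -, hiv, -⟩ := level_dictionary (d := d) (n := n) hL (j + 1) hUu hα hα3 hα4 h52 hb hXb' hsmall hc₃ (j + 1) le_rfl
  unfold strippedConstraint
  congr 1
  funext r κ
  have hcfg : strippedCfg L j Us (X : TDir d n (L * tower L N j)) (boxVec N r) κ
      = avgIter L Us (j + 1) (boxVec N r) κ * expUnit (Ad (avgIter L Us (j + 1) (boxVec N r) κ)⁻¹
          (logCovIter L Us (adField Us (chartDir (ContinuousLinearMap.id ℝ (Matrix n n ℂ)) (L * tower L N j) (X : TDir d n (L * tower L N j)))) (j + 1) (boxVec N r) κ)) := by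
    show dbavgCovIter L Us (relPert Us (chartDir (ContinuousLinearMap.id ℝ (Matrix n n ℂ)) (L * tower L N j) (X : TDir d n (L * tower L N j)))) (j + 1) (boxVec N r) κ
        * cavgIter L (j + 1) Us (boxVec N r) κ = _
    rw [hii, cavgIter_eq_avgIter]
    exact expUnit_Ad_mul _ _
  have hn : ‖Ad (avgIter L Us (j + 1) (boxVec N r) κ)⁻¹
      (logCovIter L Us (adField Us (chartDir (ContinuousLinearMap.id ℝ (Matrix n n ℂ)) (L * tower L N j) (X : TDir d n (L * tower L N j)))) (j + 1) (boxVec N r) κ)‖ < Real.log 2 :=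
    (hiv (boxVec N r) κ).trans_lt hlog
  simp only [relLog, hcfg, Units.val_mul, ← mul_assoc, cavgIter_eq_avgIter, Units.inv_mul, one_mul, val_expUnit]
  exact mlog_exp hn

/-- **THE STRIPPED CONSTRAINT MAP IS `C²` AT `0`** (see the module docstring) — the hypothesis `ContDiffAt ℝ 2 Ψ 0` of ✓ `NE7StrippedConstraintSocket.multiplier_transport_levelQ` for
`Ψ = strippedConstraint L N j U♯`. [folklore] -/
theorem contDiffAt_strippedConstraint [Nonempty n] {L N : ℕ} [NeZero L] [NeZero N] (hL : 2 ≤ L) (j : ℕ)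
    {Us : Site d → Fin d → (Matrix n n ℂ)ˣ} (hUu : IsUnitaryCfg Us) {α₀ : ℝ} (hα : 0 < α₀) (hα3 : B7Prop2Explicit.C0 d * α₀ ≤ 1 / 3)
    (hα4 : 4 * α₀ ≤ B7Prop2Explicit.c2' d L) (h52 : B7Prop2Explicit.pdev Us < α₀ * (((L : ℝ) ^ (j + 1))⁻¹) ^ 2)
    (hroom : Real.exp (4 * (800 * ((d : ℝ) + 1) ^ 2 * ((d : ℝ) + 4)) * α₀) ≤ 3 / 2) :
    ContDiffAt ℝ 2 (strippedConstraint L N j Us) 0 := by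
  haveI : NeZero (L * tower L N j) := ⟨Nat.mul_ne_zero (NeZero.ne L) (tower_ne_zero L N j)⟩
  have hroom2 : Real.exp (4 * (800 * ((d : ℝ) + 1) ^ 2 * ((d : ℝ) + 4)) * α₀) ≤ 2 := hroom.trans (by norm_num)
  -- the smooth model: `X ↦ skewPR (levelField (X : TDir))`
  have hF := contDiffAt_levelField (M := L * tower L N j) (N := N) hL j hUu hα hα3 hα4 h52 hroom2
  have hmodel : ContDiffAt ℝ 2 (fun X : ↥(skewSub d n (L * tower L N j)) => skewPR N (fun (r : Fin d → Fin N) (κ : Fin d) =>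
      Ad (avgIter L Us (j + 1) (boxVec N r) κ)⁻¹
        (logCovIter L Us (adField Us (chartDir (ContinuousLinearMap.id ℝ (Matrix n n ℂ)) (L * tower L N j) (X : TDir d n (L * tower L N j)))) (j + 1) (boxVec N r) κ))) 0 := by
    have h1 : ContDiffAt ℝ 2 (fun X : TDir d n (L * tower L N j) => fun (r : Fin d → Fin N) (κ : Fin d) =>
        Ad (avgIter L Us (j + 1) (boxVec N r) κ)⁻¹
          (logCovIter L Us (adField Us (chartDir (ContinuousLinearMap.id ℝ (Matrix n n ℂ)) (L * tower L N j) X)) (j + 1) (boxVec N r) κ))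
        ((skewSub d n (L * tower L N j)).subtypeL 0) := by
      rw [map_zero]; exact hF
    exact (skewPR (d := d) (n := n) N).contDiff.contDiffAt.comp 0 (h1.comp 0 (skewSub d n (L * tower L N j)).subtypeL.contDiff.contDiffAt)
  -- the stripped constraint agrees with the model near `0`
  refine hmodel.congr_of_eventuallyEq ?_
  have hLp : 0 < (L : ℝ) ^ (j + 1) := by positivity
  have hc3 : 0 < B7Prop3Flat.c3 d L := by unfold B7Prop3Flat.c3; positivity
  have hlog2 : 0 < Real.log 2 := Real.log_pos (by norm_num)
  have hρ0 : (0 : ℝ) < min (1 / (24 * (131072 * ((d : ℝ) + 1) ^ 2) * (L : ℝ) ^ (j + 1)))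
      (min (B7Prop3Flat.c3 d L / (2 * (L : ℝ) ^ (j + 1))) (Real.log 2 / (4 * (L : ℝ) ^ (j + 1)))) := by positivity
  refine ((eventually_norm_sub_lt (0 : ↥(skewSub d n (L * tower L N j))) hρ0).mono fun X hX => ?_)
  rw [sub_zero] at hX
  have h1 : ‖X‖ ≤ 1 / (24 * (131072 * ((d : ℝ) + 1) ^ 2) * (L : ℝ) ^ (j + 1)) := hX.le.trans (min_le_left _ _)
  have h2 : ‖X‖ ≤ B7Prop3Flat.c3 d L / (2 * (L : ℝ) ^ (j + 1)) := hX.le.trans ((min_le_right _ _).trans (min_le_left _ _))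
  have h3 : ‖X‖ ≤ Real.log 2 / (4 * (L : ℝ) ^ (j + 1)) := hX.le.trans ((min_le_right _ _).trans (min_le_right _ _))
  have hX0 : 0 ≤ ‖X‖ := norm_nonneg _
  have hsmall : Real.exp (4 * (800 * ((d : ℝ) + 1) ^ 2 * ((d : ℝ) + 4)) * α₀) * (1 + 8 * (131072 * ((d : ℝ) + 1) ^ 2) * ((L : ℝ) ^ (j + 1) * ‖X‖)) ≤ 2 := by
    have hC : 0 < 24 * (131072 * ((d : ℝ) + 1) ^ 2) * (L : ℝ) ^ (j + 1) := by positivity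
    have ht : 8 * (131072 * ((d : ℝ) + 1) ^ 2) * ((L : ℝ) ^ (j + 1) * ‖X‖) ≤ 1 / 3 := by
      have := (le_div_iff₀ hC).mp h1
      nlinarith
    calc Real.exp (4 * (800 * ((d : ℝ) + 1) ^ 2 * ((d : ℝ) + 4)) * α₀) * (1 + 8 * (131072 * ((d : ℝ) + 1) ^ 2) * ((L : ℝ) ^ (j + 1) * ‖X‖))
        ≤ (3 / 2) * (1 + 1 / 3) := mul_le_mul hroom (by linarith) (by positivity) (by norm_num)
      _ = 2 := by norm_num
  have hc₃ : 2 * ((L : ℝ) ^ (j + 1) * ‖X‖) ≤ B7Prop3Flat.c3 d L := by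
    have := (le_div_iff₀ (by positivity : (0 : ℝ) < 2 * (L : ℝ) ^ (j + 1))).mp h2
    nlinarith
  have hlog : 2 * ((L : ℝ) ^ (j + 1) * ‖X‖) < Real.log 2 := by
    have := (le_div_iff₀ (by positivity : (0 : ℝ) < 4 * (L : ℝ) ^ (j + 1))).mp h3
    nlinarith
  exact strippedConstraint_eq_skewPR_levelField (N := N) hL j hUu hα hα3 hα4 h52 X le_rfl hsmall hc₃ hlog

end

end Summit.QuantumFields.BalabanUV.T4Continuum.NE7StrippedConstraintC2
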